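import Summits.ResolutionOfSingularities.ResolutionOfSingularities.Theorems.FrobeniusLadderFInjectiveMacaulayficationCISmoothChart
import Summits.ResolutionOfSingularities.ResolutionOfSingularities.Theorems.FrobeniusLadderFInjectiveMacaulayficationCIChartPresentationLocal
import Mathlib.LinearAlgebra.Matrix.Block
import Mathlib.Data.Finset.Sort
import HarnessLib

/-!
# The ORBIT expected dimension on a smooth chart of the CI-CN engine is a Jacobian minor

Support file for crux stmt-ResolutionOfSingularities-15315 (`FrobeniusLadder.FInjectiveMacaulayfication`), chain w45a, seat
res-L1-w45a-stub-6 (res-D-pv-018, D→L convert), file 9 of the CI-CN engine — the answer to stub-1's «one design question left for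
the G5ᶜⁱ glue» (STATUS 06:22:16Z): how a specimen certifies, UNIFORMLY over a chart, the ORBIT EXPECTED DIMENSION
`dim k[Y]_Q̃ ⧸ (g₁, …, g_c, Y_S) + (c + |S|) = dim k[Y]_Q̃` (`S = {i : Yᵢ ∈ Q̃}`), the binder of
`CIChartPresentationLocal.isSMulRegular_algebraMap_X_of_expectedDim` / `nonempty_localization_ringEquiv` (C1ᶜⁱ, stub-1) and of
`CIChartCore.ciChartCore'`. [OURS · L1 W4.5a] — NOT a statement of the manuscript [claim: Hironaka2017]; AI-written, weaker than
expert review.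

ON A SMOOTH (Khovanskii) CHART IT IS A JACOBIAN MINOR: if a `c×c` minor `μ = det(∂g_l/∂Y_{js i})` with columns `js i ∉ S` lies outside
`Q̃`, then the `(c+|S|)×(c+|S|)` Jacobian of the family `(g₁, …, g_c, Yᵢ (i ∈ S))` w.r.t. `(∂/∂Y_{js i}, ∂/∂Y_i (i ∈ S))` is block
triangular with determinant `μ · 1`, so `CIJacobian.isRegularLocalRing_quotient_of_det_not_mem` (Matsumura 30.4 (ii) Step 1 + Thm. 14.2, no
height hypothesis) applied to that family gives regularity AND the orbit expected dimension. The minor itself is certified stratum-uniformly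
by the smooth-face certificate of `…CISmoothChart` (`μ(g) ≡ μ(g^S) mod (Y_S)`).

* `det_jacobian_append_X` — the block determinant.
* `orbitExpectedDim_of_det_not_mem` — minor `∉ Q̃` ⇒ ORBIT-ED at `Q̃` (with `Y_S` enumerated by `S.orderEmbOfFin`).
* `orbitExpectedDim_of_smoothFaceCertificate` — the same from the file-8 certificate datum of the stratum.
* `isSMulRegular_X_of_smoothFaceCertificate` — the `hX` binder of stub-1's `nonempty_localization_ringEquiv(_quotientChart)`:
  every `Yᵢ ∈ Q̃` is a non-zero-divisor on `k[Y]_Q̃ ⧸ (g)` (via stub-1's `isSMulRegular_algebraMap_X_of_expectedDim`, cited).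

No definitions, no named facts; glue. [folklore; cite: Matsumura1987, Thm. 30.4 (ii) and Thm. 14.2]
-/

-- single-problem summit: the doubled namespace component is forced
set_option linter.dupNamespace false

noncomputable section

namespace Summit.ResolutionOfSingularities.ResolutionOfSingularities.Theorems.FInjectiveMacaulayfication.CIOrbitExpectedDim

open MvPolynomial IsLocalRing
open Summit.ResolutionOfSingularities.ResolutionOfSingularities.Theorems.FInjectiveMacaulayfication

variable {k : Type} [CommRing k] {n : ℕ}

/-! ## §1 The block determinant -/

/-- **The Jacobian of `(g₁, …, g_c, Y_{σ 1}, …, Y_{σ s})` w.r.t. `(∂_{js 1}, …, ∂_{js c}, ∂_{σ 1}, …, ∂_{σ s})` has determinant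
`det(∂_{js i} g_l)`** when `σ` is injective and no `js i` is a `σ t` (block triangular with identity lower-right block). [folklore] -/
theorem det_jacobian_append_X {c s : ℕ} (gs : Fin c → MvPolynomial (Fin n) k) (js : Fin c → Fin n) (σ : Fin s → Fin n)
    (hσ : Function.Injective σ) (hjs : ∀ i t, js i ≠ σ t) :
    (Matrix.of fun i j => (Fin.append (fun i => ((pderiv (js i)).restrictScalars ℤ :
        Derivation ℤ (MvPolynomial (Fin n) k) (MvPolynomial (Fin n) k))) (fun t => (pderiv (σ t)).restrictScalars ℤ) i)
      (Fin.append gs (fun t => (X (σ t) : MvPolynomial (Fin n) k)) j)).det =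
      (Matrix.of fun i l => pderiv (js i) (gs l)).det := by
  classical
  set M : Matrix (Fin (c + s)) (Fin (c + s)) (MvPolynomial (Fin n) k) := Matrix.of fun i j =>
    (Fin.append (fun i => ((pderiv (js i)).restrictScalars ℤ :
        Derivation ℤ (MvPolynomial (Fin n) k) (MvPolynomial (Fin n) k))) (fun t => (pderiv (σ t)).restrictScalars ℤ) i)
      (Fin.append gs (fun t => (X (σ t) : MvPolynomial (Fin n) k)) j) with hM
  set A : Matrix (Fin c) (Fin c) (MvPolynomial (Fin n) k) := Matrix.of fun i l => pderiv (js i) (gs l) with hA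
  set C : Matrix (Fin s) (Fin c) (MvPolynomial (Fin n) k) := Matrix.of fun t l => pderiv (σ t) (gs l) with hC
  have hblocks : M = Matrix.reindex finSumFinEquiv finSumFinEquiv (Matrix.fromBlocks A 0 C 1) := by
    ext i j
    obtain ⟨x, rfl⟩ := finSumFinEquiv.surjective i
    obtain ⟨y, rfl⟩ := finSumFinEquiv.surjective j
    rw [Matrix.reindex_apply, Matrix.submatrix_apply, Equiv.symm_apply_apply, Equiv.symm_apply_apply, hM, Matrix.of_apply]
    rcases x with i | t <;> rcases y with l | t'
    · rw [finSumFinEquiv_apply_left, finSumFinEquiv_apply_left, Fin.append_left, Fin.append_left,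
        Matrix.fromBlocks_apply₁₁, hA, Matrix.of_apply, Derivation.restrictScalars_apply]
    · rw [finSumFinEquiv_apply_left, finSumFinEquiv_apply_right, Fin.append_left, Fin.append_right,
        Matrix.fromBlocks_apply₁₂, Matrix.zero_apply, Derivation.restrictScalars_apply, pderiv_X_of_ne (hjs i t').symm]
    · rw [finSumFinEquiv_apply_right, finSumFinEquiv_apply_left, Fin.append_right, Fin.append_left,
        Matrix.fromBlocks_apply₂₁, hC, Matrix.of_apply, Derivation.restrictScalars_apply]
    · rw [finSumFinEquiv_apply_right, finSumFinEquiv_apply_right, Fin.append_right, Fin.append_right,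
        Matrix.fromBlocks_apply₂₂, Derivation.restrictScalars_apply, pderiv_X, Matrix.one_apply]
      by_cases h : t = t'
      · subst h; simp
      · rw [if_neg h, Pi.single_eq_of_ne (fun h' => h (hσ h').symm)]
  rw [hblocks, Matrix.det_reindex_self, Matrix.det_fromBlocks_zero₁₂, Matrix.det_one, mul_one]

/-! ## §2 ORBIT-ED from a Jacobian minor -/

section Field

variable {K : Type} [Field K]

/-- **THE ORBIT EXPECTED DIMENSION FROM A JACOBIAN MINOR.** `Q̃` a prime of `K[Y₀, …, Y_{n-1}]` containing `g₁, …, g_c`, `S` the set of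
coordinates in `Q̃` (enumerated increasingly by `S.orderEmbOfFin`), and a `c×c` minor `det(∂g_l/∂Y_{js i})` with columns off `S` outside
`Q̃`. Then `dim K[Y]_Q̃ ⧸ (g₁, …, g_c, Y_S) + (c + |S|) = dim K[Y]_Q̃` — the ORBIT-ED binder of the CI-CN engine, in the list form of
`CIChartPresentationLocal.isSMulRegular_algebraMap_X_of_expectedDim`. [cite: Matsumura1987, Thm. 30.4 (ii) and Thm. 14.2] -/
theorem orbitExpectedDim_of_det_not_mem {c : ℕ} (gs : Fin c → MvPolynomial (Fin n) K)
    (Q : Ideal (MvPolynomial (Fin n) K)) [Q.IsPrime] (hgs : ∀ l, gs l ∈ Q) (S : Finset (Fin n))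
    (hS : ∀ i : Fin n, i ∈ S ↔ (X i : MvPolynomial (Fin n) K) ∈ Q)
    (js : Fin c → Fin n) (hjs : ∀ i, js i ∉ S) (hdet : (Matrix.of fun i l => pderiv (js i) (gs l)).det ∉ Q) :
    ringKrullDim (Localization.AtPrime Q ⧸ Ideal.ofList
        (List.ofFn (fun l : Fin c => algebraMap (MvPolynomial (Fin n) K) (Localization.AtPrime Q) (gs l)) ++
         List.ofFn (fun t : Fin S.card => algebraMap (MvPolynomial (Fin n) K) (Localization.AtPrime Q)
           (X (S.orderEmbOfFin rfl t))))) + ((c + S.card : ℕ) : WithBot ℕ∞) =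
      ringKrullDim (Localization.AtPrime Q) := by
  classical
  set σ : Fin S.card → Fin n := fun t => S.orderEmbOfFin rfl t with hσ_def
  have hσinj : Function.Injective σ := (S.orderEmbOfFin rfl).injective
  have hσS : ∀ t, σ t ∈ S := fun t => S.orderEmbOfFin_mem rfl t
  have hjsσ : ∀ i t, js i ≠ σ t := fun i t h => hjs i (h ▸ hσS t)
  -- the family `(g, Y_S)` and its derivations
  set f : Fin (c + S.card) → MvPolynomial (Fin n) K := Fin.append gs (fun t => (X (σ t) : MvPolynomial (Fin n) K))
    with hf
  set D : Fin (c + S.card) → Derivation ℤ (MvPolynomial (Fin n) K) (MvPolynomial (Fin n) K) :=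
    Fin.append (fun i => (pderiv (js i)).restrictScalars ℤ) (fun t => (pderiv (σ t)).restrictScalars ℤ) with hD
  have hfQ : ∀ j, f j ∈ Q := by
    intro j
    obtain ⟨x, rfl⟩ := finSumFinEquiv.surjective j
    rcases x with l | t
    · rw [finSumFinEquiv_apply_left, hf, Fin.append_left]; exact hgs l
    · rw [finSumFinEquiv_apply_right, hf, Fin.append_right]; exact (hS _).mp (hσS t)
  have hdet' : (Matrix.of fun i j => D i (f j)).det ∉ Q := by
    rw [hD, hf, det_jacobian_append_X gs js σ hσinj hjsσ]
    exact hdet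
  haveI : IsRegularLocalRing (Localization.AtPrime Q) := IsRegularRing.isRegularLocalRing_localization Q
  obtain ⟨-, hdim⟩ := CIJacobian.isRegularLocalRing_quotient_of_det_not_mem Q D f hfQ hdet'
  -- identify the ideal `(f/1)` with the list ideal `(g/1) ++ (Y_S/1)`
  set L := Localization.AtPrime Q
  have hideal : Ideal.span (Set.range fun j => algebraMap (MvPolynomial (Fin n) K) L (f j)) =
      Ideal.ofList (List.ofFn (fun l : Fin c => algebraMap (MvPolynomial (Fin n) K) L (gs l)) ++
        List.ofFn (fun t : Fin S.card => algebraMap (MvPolynomial (Fin n) K) L (X (σ t)))) := by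
    have happ : (fun j => algebraMap (MvPolynomial (Fin n) K) L (f j)) =
        Fin.append (fun l : Fin c => algebraMap (MvPolynomial (Fin n) K) L (gs l))
          (fun t : Fin S.card => algebraMap (MvPolynomial (Fin n) K) L (X (σ t))) := by
      funext j
      obtain ⟨x, rfl⟩ := finSumFinEquiv.surjective j
      rcases x with l | t
      · rw [finSumFinEquiv_apply_left, hf, Fin.append_left, Fin.append_left]
      · rw [finSumFinEquiv_apply_right, hf, Fin.append_right, Fin.append_right]
    rw [happ, ← List.ofFn_fin_append]
    have hset : {x : L | x ∈ List.ofFn (Fin.append (fun l : Fin c => algebraMap (MvPolynomial (Fin n) K) L (gs l))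
        (fun t : Fin S.card => algebraMap (MvPolynomial (Fin n) K) L (X (σ t))))} =
        Set.range (Fin.append (fun l : Fin c => algebraMap (MvPolynomial (Fin n) K) L (gs l))
          (fun t : Fin S.card => algebraMap (MvPolynomial (Fin n) K) L (X (σ t)))) :=
      Set.ext fun x => by simp only [Set.mem_setOf_eq, List.mem_ofFn', Set.mem_range]
    change _ = Ideal.span {x : L | x ∈ _}
    rw [hset]
  rw [← hideal]
  exact hdim

/-- **ORBIT-ED from the smooth-face certificate of the stratum** (the datum of `CISmoothChart.ci_clause_of_smoothFaceCertificate`): a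
monomial off `S` in `(g^S) + (coordinate minors of g^S)`, `g^S = g(Y_S = 0)`, at a prime `Q̃ ∋ g₁, …, g_c` of `K[Y]` on stratum `S`.
[cite: Matsumura1987, Thm. 30.4 (ii) and Thm. 14.2] -/
theorem orbitExpectedDim_of_smoothFaceCertificate {c : ℕ} (gs : Fin c → MvPolynomial (Fin n) K)
    (Q : Ideal (MvPolynomial (Fin n) K)) [Q.IsPrime] (hgs : ∀ l, gs l ∈ Q) (S : Finset (Fin n))
    (hS : ∀ i : Fin n, i ∈ S ↔ (X i : MvPolynomial (Fin n) K) ∈ Q)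
    (t : ℕ) (js : Fin t → Fin c → Fin n) (e : Fin n →₀ ℕ) (he : ∀ i ∈ S, e i = 0)
    (hcert : (monomial e (1 : K) : MvPolynomial (Fin n) K) ∈
      Ideal.span (Set.range fun l : Fin c =>
          aeval (fun i : Fin n => if i ∈ S then (0 : MvPolynomial (Fin n) K) else X i) (gs l)) ⊔
        Ideal.span (Set.range fun μ : Fin t => (Matrix.of fun i l => pderiv (js μ i)
          (aeval (fun i : Fin n => if i ∈ S then (0 : MvPolynomial (Fin n) K) else X i) (gs l))).det)) :
    (∃ μ : Fin t, (∀ i, js μ i ∉ S) ∧ (Matrix.of fun i l => pderiv (js μ i) (gs l)).det ∉ Q) ∧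
    ringKrullDim (Localization.AtPrime Q ⧸ Ideal.ofList
        (List.ofFn (fun l : Fin c => algebraMap (MvPolynomial (Fin n) K) (Localization.AtPrime Q) (gs l)) ++
         List.ofFn (fun t : Fin S.card => algebraMap (MvPolynomial (Fin n) K) (Localization.AtPrime Q)
           (X (S.orderEmbOfFin rfl t))))) + ((c + S.card : ℕ) : WithBot ℕ∞) =
      ringKrullDim (Localization.AtPrime Q) := by
  classical
  have hprime : Q.IsPrime := inferInstance
  -- the stratum ideal `(Y_S)` lies in `Q`; `Y^e ∉ Q`
  have hSQ : Ideal.span ((fun i : Fin n => (X i : MvPolynomial (Fin n) K)) '' (S : Set (Fin n))) ≤ Q := by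
    refine Ideal.span_le.mpr ?_
    rintro _ ⟨i, hi, rfl⟩
    exact (hS i).mp (Finset.mem_coe.mp hi)
  have hmonQ : (monomial e (1 : K) : MvPolynomial (Fin n) K) ∉ Q := by
    intro hmem
    rw [monomial_eq, C_1, one_mul, Finsupp.prod] at hmem
    obtain ⟨i, hi, hXi⟩ := Ideal.IsPrime.prod_mem_iff.mp hmem
    have hXQ : (X i : MvPolynomial (Fin n) K) ∈ Q := hprime.mem_of_pow_mem _ hXi
    have := he i ((hS i).mpr hXQ)
    rw [Finsupp.mem_support_iff] at hi
    exact hi this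
  have hgSQ : ∀ l, aeval (fun i : Fin n => if i ∈ S then (0 : MvPolynomial (Fin n) K) else X i) (gs l) ∈ Q := by
    intro l
    have h := Q.sub_mem (hgs l) (hSQ (CISmoothChart.sub_substZero_mem S (gs l)))
    rwa [sub_sub_cancel] at h
  -- some restricted minor lies outside `Q`
  have hex : ∃ μ : Fin t, (Matrix.of fun i l => pderiv (js μ i)
      (aeval (fun i : Fin n => if i ∈ S then (0 : MvPolynomial (Fin n) K) else X i) (gs l))).det ∉ Q := by
    by_contra hall
    have hall' : ∀ μ : Fin t, (Matrix.of fun i l => pderiv (js μ i)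
        (aeval (fun i : Fin n => if i ∈ S then (0 : MvPolynomial (Fin n) K) else X i) (gs l))).det ∈ Q :=
      fun μ => not_not.mp (not_exists.mp hall μ)
    have hle : Ideal.span (Set.range fun l : Fin c =>
          aeval (fun i : Fin n => if i ∈ S then (0 : MvPolynomial (Fin n) K) else X i) (gs l)) ⊔
        Ideal.span (Set.range fun μ : Fin t => (Matrix.of fun i l => pderiv (js μ i)
          (aeval (fun i : Fin n => if i ∈ S then (0 : MvPolynomial (Fin n) K) else X i) (gs l))).det) ≤ Q := by
      refine sup_le (Ideal.span_le.mpr ?_) (Ideal.span_le.mpr ?_)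
      · rintro _ ⟨l, rfl⟩; exact hgSQ l
      · rintro _ ⟨μ, rfl⟩; exact hall' μ
    exact hmonQ (hle hcert)
  obtain ⟨μ, hμ⟩ := hex
  -- its columns are off `S`
  have hjs : ∀ i, js μ i ∉ S := by
    intro i hi
    apply hμ
    have hrow : ∀ l, pderiv (js μ i)
        (aeval (fun i : Fin n => if i ∈ S then (0 : MvPolynomial (Fin n) K) else X i) (gs l)) = 0 := by
      intro l
      induction (gs l) using MvPolynomial.induction_on' with
      | monomial e' c' =>
        rw [ToricChartFedder.substZero_monomial]
        by_cases h : ∀ i ∈ S, e' i = 0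
        · rw [if_pos h, pderiv_monomial, h _ hi, Nat.cast_zero, mul_zero, monomial_zero]
        · rw [if_neg h, map_zero]
      | add f₁ f₂ hf₁ hf₂ => rw [map_add, map_add, hf₁, hf₂, add_zero]
    have hdet0 : (Matrix.of fun i l => pderiv (js μ i)
        (aeval (fun i : Fin n => if i ∈ S then (0 : MvPolynomial (Fin n) K) else X i) (gs l))).det = 0 := by
      refine Matrix.det_eq_zero_of_row_eq_zero i fun l => ?_
      rw [Matrix.of_apply, hrow l]
    rw [hdet0]
    exact Q.zero_mem
  -- hence the minor of `g` itself is outside `Q`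
  have hminor : (Matrix.of fun i l => pderiv (js μ i) (gs l)).det ∉ Q := by
    intro hmem
    apply hμ
    rw [CISmoothChart.det_pderiv_substZero S (js μ) hjs gs]
    have h := Q.sub_mem hmem (hSQ (CISmoothChart.sub_substZero_mem S ((Matrix.of fun i l => pderiv (js μ i) (gs l)).det)))
    rwa [sub_sub_cancel] at h
  exact ⟨⟨μ, hjs, hminor⟩, orbitExpectedDim_of_det_not_mem gs Q hgs S hS (js μ) hjs hminor⟩

/-- **Every `Yᵢ ∈ Q̃` is a non-zero-divisor on `K[Y]_Q̃ ⧸ (g₁, …, g_c)` on a smooth chart** — the `hX` binder of stub-1's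
`CIChartPresentationLocal.nonempty_localization_ringEquiv` / `CIChartPresentationBridge.nonempty_localization_ringEquiv_quotientChart`,
from the smooth-face certificate of the stratum (ORBIT-ED above, then `CIChartPresentationLocal.isSMulRegular_algebraMap_X_of_expectedDim`).
[folklore; cite: Matsumura1987, Thm. 30.4 (ii), Thm. 14.2, Thm. 17.4] -/
theorem isSMulRegular_X_of_smoothFaceCertificate {c : ℕ} (gs : Fin c → MvPolynomial (Fin n) K)
    (Q : Ideal (MvPolynomial (Fin n) K)) [Q.IsPrime] (hgs : ∀ l, gs l ∈ Q) (S : Finset (Fin n))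
    (hS : ∀ i : Fin n, i ∈ S ↔ (X i : MvPolynomial (Fin n) K) ∈ Q)
    (t : ℕ) (js : Fin t → Fin c → Fin n) (e : Fin n →₀ ℕ) (he : ∀ i ∈ S, e i = 0)
    (hcert : (monomial e (1 : K) : MvPolynomial (Fin n) K) ∈
      Ideal.span (Set.range fun l : Fin c =>
          aeval (fun i : Fin n => if i ∈ S then (0 : MvPolynomial (Fin n) K) else X i) (gs l)) ⊔
        Ideal.span (Set.range fun μ : Fin t => (Matrix.of fun i l => pderiv (js μ i)
          (aeval (fun i : Fin n => if i ∈ S then (0 : MvPolynomial (Fin n) K) else X i) (gs l))).det)) :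
    ∀ i : Fin n, (X i : MvPolynomial (Fin n) K) ∈ Q →
      IsSMulRegular (Localization.AtPrime Q ⧸ (Ideal.span (Set.range gs)).map
          (algebraMap (MvPolynomial (Fin n) K) (Localization.AtPrime Q)))
        (algebraMap (MvPolynomial (Fin n) K) (Localization.AtPrime Q) (X i)) := by
  classical
  haveI : IsRegularLocalRing (Localization.AtPrime Q) := IsRegularRing.isRegularLocalRing_localization Q
  obtain ⟨-, hdim⟩ := orbitExpectedDim_of_smoothFaceCertificate gs Q hgs S hS t js e he hcert
  set L := Localization.AtPrime Q
  set ys : List L := List.ofFn (fun t : Fin S.card => algebraMap (MvPolynomial (Fin n) K) L (X (S.orderEmbOfFin rfl t)))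
    with hys_def
  have hys : ∀ y ∈ ys, y ∈ maximalIdeal L := by
    intro y hy
    obtain ⟨t, rfl⟩ := List.mem_ofFn.mp hy
    exact (IsLocalization.AtPrime.to_map_mem_maximal_iff L Q _).mpr ((hS _).mp (S.orderEmbOfFin_mem rfl t))
  have hgsm : ∀ l : Fin c, algebraMap (MvPolynomial (Fin n) K) L (gs l) ∈ maximalIdeal L := fun l =>
    (IsLocalization.AtPrime.to_map_mem_maximal_iff L Q _).mpr (hgs l)
  have hXys : ∀ i : Fin n, (X i : MvPolynomial (Fin n) K) ∈ Q → algebraMap (MvPolynomial (Fin n) K) L (X i) ∈ ys := by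
    intro i hi
    have hiS : i ∈ S := (hS i).mpr hi
    have hir : i ∈ Set.range (S.orderEmbOfFin rfl) := by
      rw [Finset.range_orderEmbOfFin]; exact Finset.mem_coe.mpr hiS
    obtain ⟨t, ht⟩ := hir
    rw [hys_def]
    exact List.mem_ofFn.mpr ⟨t, by simp only [ht]⟩
  have hlen : ys.length = S.card := by rw [hys_def, List.length_ofFn]
  have hdim' : ringKrullDim (L ⧸ Ideal.ofList
      (List.ofFn (fun l : Fin c => algebraMap (MvPolynomial (Fin n) K) L (gs l)) ++ ys)) +
      ((c + ys.length : ℕ) : WithBot ℕ∞) = ringKrullDim L := by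
    rw [hlen]; exact hdim
  exact CIChartPresentationLocal.isSMulRegular_algebraMap_X_of_expectedDim (gs := gs) Q ys hys hgsm hXys hdim'

end Field

end Summit.ResolutionOfSingularities.ResolutionOfSingularities.Theorems.FInjectiveMacaulayfication.CIOrbitExpectedDim

end
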